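import Literature.Probability.Divergences.RenyiDivergence
import Mathlib.Probability.ProbabilityMassFunction.Basic
import Mathlib.MeasureTheory.Integral.Lebesgue.Countable
import HarnessLib

/-!
# Bridge: the Hellinger integral of two probability mass functions is the Rényi power sum

Topic `Probability/Divergences`; namespace `Literature.Probability.Divergences`. PROVED, no definition, no named
fact. For laws `P Q : PMF α` on a COUNTABLE carrier with `Supp(P) ⊆ Supp(Q)` (the printed standing hypothesis of the
crypto-convention Rényi divergence), the tree's general object `hellingerIntegral a P.toMeasure Q.toMeasure = ∫ (dP/dQ)^a dQ`
(`RenyiDivergence.lean`, [vEH14] Def. 2) IS the power sum `Σ_x P(x)^a · Q(x)^{1−a}` (values in `ℝ≥0∞`, real exponent), i.e.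
`R_a(P‖Q)^{a−1}` of [FGdGJK26] §2.4 Def. 8 / [Pre17] §2.2 Def. 1 / [BLL+15]: «`R_a(P‖Q) = (Σ_{x∈Supp(P)} P(x)^a/Q(x)^{a−1})^{1/(a−1)}`»
(HAL hal-05635650v1 p0013; held volume `book:editornd-advances-cryptology-asiacrypt-2017` chunk p0468 L14–L16). This is the
identity a countable-carrier user (e.g. a lattice-coset Gaussian vs a preimage sampler's law) needs to read the measure-level
probability preservation (`RenyiProbabilityPreservation.lean`) and multiplicativity (`RenyiTensorization.lean`) on the sum it
writes inline; on a `Fintype` the sum is `RenyiFinite.renyiSumFin` of the real weight vectors (not restated here).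

* `PMF.toMeasure_eq_withDensity_toMeasure` — `P = Q.withDensity (P/Q)` as measures when `Q x = 0 ⇒ P x = 0`;
* `PMF.rnDeriv_toMeasure_ae_eq` — `dP/dQ = P/Q` `Q`-a.e.;
* `PMF.toMeasure_absolutelyContinuous` — `P.toMeasure ≪ Q.toMeasure`;
* `hellingerIntegral_toMeasure_eq_tsum` — `hellingerIntegral a P Q = Σ' x, P x ^ a * Q x ^ (1 − a)` for `0 < a`;
* `PMF.tsum_rpow_mul_rpow_eq_ofReal` — the `ℝ≥0∞` power sum is `ofReal` of the real power sum of the `toReal` weights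
  (transfer to / from the real-weight lemmas of `RenyiFinite` / `RenyiSummableTailcutRelativeError`).
-/

noncomputable section

open MeasureTheory Set
open scoped ENNReal

namespace Literature.Probability.Divergences

variable {α : Type*} [MeasurableSpace α] [MeasurableSingletonClass α] [Countable α]

/-- On a countable carrier, `P = Q · (P/Q)` as measures when `Supp(P) ⊆ Supp(Q)`. [cite: FouqueEtAl2026CloserLookFalcon, §2.4 Def. 8 (support condition `sup(P) ⊆ sup(Q)`); elementary/ours] -/
theorem PMF.toMeasure_eq_withDensity_toMeasure (P Q : PMF α) (hsupp : ∀ x, Q x = 0 → P x = 0) :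
    P.toMeasure = Q.toMeasure.withDensity (fun x => P x / Q x) := by
  refine Measure.ext_of_singleton fun x => ?_
  rw [PMF.toMeasure_apply_singleton _ _ (measurableSet_singleton x),
    withDensity_apply _ (measurableSet_singleton x), lintegral_singleton,
    PMF.toMeasure_apply_singleton _ _ (measurableSet_singleton x)]
  by_cases hQ : Q x = 0
  · rw [hQ, hsupp x hQ, mul_zero]
  · rw [ENNReal.div_mul_cancel hQ (PMF.apply_ne_top Q x)]

/-- `P.toMeasure ≪ Q.toMeasure` when `Supp(P) ⊆ Supp(Q)`. [cite: FouqueEtAl2026CloserLookFalcon, §2.4 Def. 8; elementary/ours] -/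
theorem PMF.toMeasure_absolutelyContinuous (P Q : PMF α) (hsupp : ∀ x, Q x = 0 → P x = 0) :
    P.toMeasure ≪ Q.toMeasure := by
  rw [PMF.toMeasure_eq_withDensity_toMeasure P Q hsupp]
  exact withDensity_absolutelyContinuous _ _

/-- The Radon–Nikodym derivative of two PMF measures on a countable carrier is the ratio of point masses, `Q`-a.e.
[cite: FouqueEtAl2026CloserLookFalcon, §2.4 Def. 8; elementary/ours] -/
theorem PMF.rnDeriv_toMeasure_ae_eq (P Q : PMF α) (hsupp : ∀ x, Q x = 0 → P x = 0) :
    P.toMeasure.rnDeriv Q.toMeasure =ᵐ[Q.toMeasure] fun x => P x / Q x := by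
  have hmeas : Measurable fun x => P x / Q x := measurable_of_countable _
  have h := Measure.rnDeriv_withDensity Q.toMeasure hmeas
  rw [← PMF.toMeasure_eq_withDensity_toMeasure P Q hsupp] at h
  exact h

/-- **The Hellinger integral of two PMFs is the Rényi power sum**: for `0 < a` and `Supp(P) ⊆ Supp(Q)`,
`hellingerIntegral a P.toMeasure Q.toMeasure = Σ' x, P(x)^a · Q(x)^{1−a}` (so the crypto-convention
`R_a(P‖Q) = (Σ' x, P x ^ a * Q x ^ (1 − a)) ^ (1/(a−1))` is `(hellingerIntegral a P Q)^{1/(a−1)}`).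
[cite: FouqueEtAl2026CloserLookFalcon, §2.4 Def. 8 (p. 12); Prest2017RenyiSharperBounds, §2.2 Def. 1] -/
theorem hellingerIntegral_toMeasure_eq_tsum (P Q : PMF α) (hsupp : ∀ x, Q x = 0 → P x = 0) {a : ℝ}
    (ha : 0 < a) :
    hellingerIntegral a P.toMeasure Q.toMeasure = ∑' x, P x ^ a * Q x ^ (1 - a) := by
  rw [hellingerIntegral_of_ac (PMF.toMeasure_absolutelyContinuous P Q hsupp)]
  have hae : (fun x => P.toMeasure.rnDeriv Q.toMeasure x ^ a) =ᵐ[Q.toMeasure] fun x => (P x / Q x) ^ a :=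
    (PMF.rnDeriv_toMeasure_ae_eq P Q hsupp).mono fun x hx => by simp only [hx]
  rw [lintegral_congr_ae hae, lintegral_countable']
  refine tsum_congr fun x => ?_
  rw [PMF.toMeasure_apply_singleton _ _ (measurableSet_singleton x)]
  by_cases hQ : Q x = 0
  · -- both sides vanish: `P x = 0`
    rw [hQ, hsupp x hQ, mul_zero, ENNReal.zero_rpow_of_pos ha, zero_mul]
  · have hQt : Q x ≠ ⊤ := PMF.apply_ne_top Q x
    rw [ENNReal.div_rpow_of_nonneg _ _ ha.le, div_eq_mul_inv,
      show (1 : ℝ) - a = 1 + -a by ring, ENNReal.rpow_add 1 (-a) hQ hQt, ENNReal.rpow_one,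
      ENNReal.rpow_neg]
    ring

/-! ## The `ℝ≥0∞` power sum of two PMFs vs the real power sum of their `toReal` weights -/

omit [MeasurableSpace α] [MeasurableSingletonClass α] [Countable α] in
/-- Termwise: `((P x)^a · (Q x)^{1−a}).toReal = (P x).toReal^a · (Q x).toReal^{1−a}` (all real exponents; the `ℝ≥0∞` junk
value `⊤ ↦ 0` and the real junk value `0^{negative} = 0` agree). [cite: FouqueEtAl2026CloserLookFalcon, §2.4 Def. 8; elementary/ours] -/
theorem PMF.toReal_rpow_mul_rpow (P Q : PMF α) (a : ℝ) (x : α) :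
    ((P x) ^ a * (Q x) ^ (1 - a)).toReal = (P x).toReal ^ a * (Q x).toReal ^ (1 - a) := by
  rw [ENNReal.toReal_mul, ← ENNReal.toReal_rpow, ← ENNReal.toReal_rpow]

omit [MeasurableSpace α] [MeasurableSingletonClass α] [Countable α] in
/-- The `ℝ≥0∞` summand is finite under `Supp(P) ⊆ Supp(Q)` and `a > 0`.
[cite: FouqueEtAl2026CloserLookFalcon, §2.4 Def. 8; elementary/ours] -/
theorem PMF.rpow_mul_rpow_ne_top (P Q : PMF α) (hsupp : ∀ x, Q x = 0 → P x = 0) {a : ℝ} (ha : 0 < a) (x : α) :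
    (P x) ^ a * (Q x) ^ (1 - a) ≠ ⊤ := by
  by_cases hQ : Q x = 0
  · rw [hQ, hsupp x hQ, ENNReal.zero_rpow_of_pos ha, zero_mul]
    exact ENNReal.zero_ne_top
  · refine ENNReal.mul_ne_top (ENNReal.rpow_ne_top_of_nonneg ha.le (PMF.apply_ne_top P x)) ?_
    intro h
    rw [ENNReal.rpow_eq_top_iff] at h
    rcases h with ⟨h0, _⟩ | ⟨htop, _⟩
    · exact hQ h0
    · exact PMF.apply_ne_top Q x htop

omit [MeasurableSpace α] [MeasurableSingletonClass α] [Countable α] in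
/-- **`ℝ≥0∞` power sum = `ofReal` of the real power sum**: for `P Q : PMF α` with `Supp(P) ⊆ Supp(Q)`, `a > 0`, and the real
family `x ↦ (P x).toReal^a (Q x).toReal^{1−a}` summable,
`Σ' x, (P x)^a (Q x)^{1−a} = ENNReal.ofReal (Σ' x, (P x).toReal^a (Q x).toReal^{1−a})` — so the real-weight lemmas
(`RenyiSummableTailcutRelativeError`, `RenyiFinite`) transfer to the `ℝ≥0∞` carrier and back.
[cite: FouqueEtAl2026CloserLookFalcon, §2.4 Def. 8; Prest2017RenyiSharperBounds, §2.2 Def. 1; elementary/ours] -/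
theorem PMF.tsum_rpow_mul_rpow_eq_ofReal (P Q : PMF α) (hsupp : ∀ x, Q x = 0 → P x = 0) {a : ℝ} (ha : 0 < a)
    (hs : Summable fun x => (P x).toReal ^ a * (Q x).toReal ^ (1 - a)) :
    ∑' x, (P x) ^ a * (Q x) ^ (1 - a) = ENNReal.ofReal (∑' x, (P x).toReal ^ a * (Q x).toReal ^ (1 - a)) := by
  have hnonneg : ∀ x, 0 ≤ (P x).toReal ^ a * (Q x).toReal ^ (1 - a) := fun x =>
    mul_nonneg (Real.rpow_nonneg ENNReal.toReal_nonneg _) (Real.rpow_nonneg ENNReal.toReal_nonneg _)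
  rw [ENNReal.ofReal_tsum_of_nonneg hnonneg hs]
  refine tsum_congr fun x => ?_
  rw [← PMF.toReal_rpow_mul_rpow, ENNReal.ofReal_toReal (PMF.rpow_mul_rpow_ne_top P Q hsupp ha x)]

end Literature.Probability.Divergences

end
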